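import Summits.Ventures.CertifiedQuantumChemistry.Rows.FrozenCoreRows
import HarnessLib

/-!
# Ventures/CertifiedQuantumChemistry — Rows/FrozenCoreLowerRowsCounterexample.lean: LOWER rows of an
# active-space model do NOT transport to the full model — a two-orbital counterexample

HONEST FRAMING (verbatim): certified bounds for a stated model Hamiltonian in a stated basis; not a
claim about the real molecule beyond that model.

Seat rdm-B (gen 20), ROWS courtesy file (theorems only; no `def`, no notation, no row of any deposited
model). `Rows/FrozenCoreRows.lean` proves that UPPER rows of a frozen-core (active-space) model `F` are
upper rows of every larger same-basis model `F'` of which `F` is the frozen-core reduction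
(`UpperRow.frozenCore`), and records that the converse for LOWER rows is false in general. This file
PROVES the falsity: `not_lowerRow_frozenCore` exhibits a full model `F' : Model 2` (one-electron
energies `h = diag(0, −1)`, no interaction, no constant), the core `C = {0}` and the EMPTY active space
(`F : Model 0`, `ecore = 2 h₀₀ = 0`, exactly the frozen-core reduction of `F'`), for which
`LowerRow F 0 0 0` holds (`F.energy 0 0 = 0`) while `LowerRow F' 1 1 0` fails (`F'.energy 1 1 ≤ −2`: the
doubly occupied orbital `1` is a (1,1)-sector trial state of energy `2 h₁₁ = −2`, HJO (10.4.20)). So no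
theorem of the shape "`LowerRow F a b lo →` (frozen-core hypotheses) `→ LowerRow F' (a + |C|) (b + |C|) lo`"
exists: a certified lower bound for an active-space model is a statement about that STATED model only.
Auxiliary: `Model.hamiltonian_fin_zero`, `Model.energy_fin_zero` (a model with no orbitals has the single
energy `ecore`).
-/

noncomputable section

namespace Summit.Ventures.CertifiedQuantumChemistry

open Matrix Finset
open Literature.MathematicalPhysics.QuantumLattice Literature.MathematicalPhysics.QuantumChemistry

/-- A model without orbitals: `H_F = ecore · 1` on the one-dimensional Fock space. -/
theorem Model.hamiltonian_fin_zero (F : Model 0) :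
    F.hamiltonian = ((F.ecore : ℚ) : ℂ) • (1 : Matrix (Finset (Orb (Fin 0))) (Finset (Orb (Fin 0))) ℂ) := by
  rw [Model.hamiltonian, molecularHamiltonian]
  simp

/-- A model without orbitals has the single energy `E(0, 0) = ecore`. -/
theorem Model.energy_fin_zero (F : Model 0) : F.energy 0 0 = F.ecore := by
  rw [Model.energy, sectorGroundEnergy_def, Matrix.minEnergyOn, Model.hamiltonian_fin_zero]
  set K : Submodule ℂ (Fock (Orb (Fin 0))) := szSector (0 + 0) ((((0 : ℕ) : ℝ) - ((0 : ℕ) : ℝ)) / 2)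
    with hK
  have hval : ∀ ψ : Fock (Orb (Fin 0)), star ψ ⬝ᵥ ψ = 1 →
      (star ψ ⬝ᵥ (((F.ecore : ℚ) : ℂ) • (1 : Matrix (Finset (Orb (Fin 0))) (Finset (Orb (Fin 0))) ℂ)) *ᵥ
        ψ).re = (F.ecore : ℝ) := by
    intro ψ h1
    rw [Matrix.smul_mulVec, one_mulVec, dotProduct_smul, h1, smul_eq_mul, mul_one]
    norm_cast
  have hset : {E : ℝ | ∃ ψ, ψ ∈ K ∧ star ψ ⬝ᵥ ψ = 1 ∧
      E = (star ψ ⬝ᵥ (((F.ecore : ℚ) : ℂ) • (1 : Matrix (Finset (Orb (Fin 0))) (Finset (Orb (Fin 0))) ℂ))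
        *ᵥ ψ).re} = {(F.ecore : ℝ)} := by
    ext E
    simp only [Set.mem_setOf_eq, Set.mem_singleton_iff]
    constructor
    · rintro ⟨ψ, -, h1, rfl⟩
      exact hval ψ h1
    · rintro rfl
      obtain ⟨ψ, hψ, hψ0⟩ := (Submodule.ne_bot_iff _).1
        (szSector_upDown_ne_bot (Λ := Fin 0) (a := 0) (b := 0) (Nat.zero_le _) (Nat.zero_le _))
      obtain ⟨c, -, hc1⟩ := exists_smul_unit hψ0
      exact ⟨c • ψ, K.smul_mem c (hK ▸ hψ), hc1, (hval _ hc1).symm⟩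
  rw [hset, csInf_singleton]

/-- The expectation of `A` in an occupation-basis vector is the diagonal entry (private bookkeeping). -/
private theorem star_single_dotProduct_mulVec_single {Λ : Type*} [LinearOrder Λ] [Fintype Λ]
    (A : Matrix (Finset (Orb Λ)) (Finset (Orb Λ)) ℂ) (T : Finset (Orb Λ)) :
    star (Pi.single T (1 : ℂ) : Fock (Orb Λ)) ⬝ᵥ A *ᵥ (Pi.single T (1 : ℂ) : Fock (Orb Λ)) = A T T := by
  have hstar : star (Pi.single T (1 : ℂ) : Fock (Orb Λ)) = (Pi.single T (1 : ℂ) : Fock (Orb Λ)) := by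
    ext s; by_cases h : s = T <;> simp [h]
  rw [hstar, single_dotProduct, one_mul, mulVec_single_one, col_apply]

/-- **LOWER ROWS DO NOT TRANSPORT FROM AN ACTIVE-SPACE MODEL TO THE FULL MODEL.** There is no theorem
"`LowerRow F a b lo →` (`F` the frozen-core reduction of `F'` along `φ` with core `C`) `→
LowerRow F' (a + |C|) (b + |C|) lo`": with `F' : Model 2`, `h = diag(0, −1)`, `eri = 0`, `ecore = 0`,
core `C = {0}` and no active orbitals, `LowerRow F 0 0 0` holds but `F'.energy 1 1 ≤ −2 < 0`. -/
theorem not_lowerRow_frozenCore :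
    ¬ ∀ (k k' : ℕ) (φ : Fin k ↪o Fin k') (C : Finset (Fin k')) (F : Model k) (F' : Model k'),
      (∀ x, φ x ∉ C) →
      (∀ x y, F.h x y = F'.h (φ x) (φ y) + ∑ c ∈ C, (F'.eri (φ x) (φ y) c c + F'.eri c c (φ x) (φ y)) -
        (1 / 2 : ℚ) * ∑ c ∈ C, (F'.eri (φ x) c c (φ y) + F'.eri c (φ y) (φ x) c)) →
      (∀ x y z w, F.eri x y z w = F'.eri (φ x) (φ y) (φ z) (φ w)) →
      F.ecore = F'.ecore + (2 * ∑ c ∈ C, F'.h c c + ∑ c ∈ C, ∑ d ∈ C, (2 * F'.eri c c d d - F'.eri c d d c)) →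
      ∀ (a b : ℕ) (lo : ℚ), LowerRow F a b lo → LowerRow F' (a + C.card) (b + C.card) lo := by
  intro H
  -- the full model: two orbitals, h = diag(0, -1), no interaction; the frozen-core model: no orbitals
  let F' : Model 2 := { h := fun p q => if p = 1 ∧ q = 1 then -1 else 0, eri := fun _ _ _ _ => 0, ecore := 0 }
  let F : Model 0 := { h := fun _ _ => 0, eri := fun _ _ _ _ => 0, ecore := 0 }
  have hF' : F'.IsSymmetric := by decide
  have φ : Fin 0 ↪o Fin 2 := OrderEmbedding.ofIsEmpty
  have hlow : LowerRow F 0 0 0 := ⟨le_rfl, le_rfl, by rw [Model.energy_fin_zero]⟩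
  have h := H 0 2 φ {0} F F' (fun x => x.elim0) (fun x => x.elim0) (fun x => x.elim0)
    (by simp [F, F']) 0 0 0 hlow
  -- h : LowerRow F' (0 + 1) (0 + 1) 0; but the doubly occupied orbital 1 has energy -2
  have hψ : IsInSector 1 1 (Pi.single (pairSet ({1} : Finset (Fin 2)) {1}) (1 : ℂ) : Fock (Orb (Fin 2))) :=
    isInSector_single_pairSet ({1} : Finset (Fin 2)) {1}
  have hle : F'.energy 1 1 ≤ -2 := by
    refine sectorGroundEnergy_le_of_rayleigh (Model.hamiltonian_isHermitian hF') hψ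
      (fun h0 => by simpa using congrFun h0 (pairSet ({1} : Finset (Fin 2)) {1})) ?_
    rw [star_single_dotProduct_mulVec_single, Model.hamiltonian, molecularHamiltonian_apply_self_closedShell]
    have h1 : star (Pi.single (pairSet ({1} : Finset (Fin 2)) {1}) (1 : ℂ) : Fock (Orb (Fin 2))) ⬝ᵥ
        (Pi.single (pairSet ({1} : Finset (Fin 2)) {1}) (1 : ℂ) : Fock (Orb (Fin 2))) = 1 := by
      have h := star_single_dotProduct_mulVec_single (1 : Matrix _ _ ℂ) (pairSet ({1} : Finset (Fin 2)) {1})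
      rwa [one_mulVec, Matrix.one_apply_eq] at h
    rw [h1]
    simp [F']
  have h0 : ((0 : ℚ) : ℝ) ≤ F'.energy 1 1 := by simpa using h.2.2
  push_cast at h0
  linarith

end Summit.Ventures.CertifiedQuantumChemistry

end
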